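import Literature.AlgebraicGeometry.ModuliOfAbelianVarieties.SiegelFamilyShimuraLocusGenericPoint
import HarnessLib

/-!
# Shimura's Prop. 10 and Prop. 12 under condition (5): polarizations of type `δ` with `jΔ = Δj` —
# for `Z ∈ 𝔜_j`, `(X_Z^δ, E_Z^δ) ≅ (X_{−Z̄}^δ, E_{−Z̄}^δ)` with `λ^ρ ∘ λ = −1`, and no real structure once
# `End(X_Z^δ)^* = {±1}` (Shimura 1972, §3 condition (5), Prop. 10, Prop. 12)

Topic `Literature/AlgebraicGeometry/ModuliOfAbelianVarieties` (the Siegel-family files, namespace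
`Literature.AlgebraicGeometry.ModuliOfAbelianVarieties.SiegelModuli`).  Lane `lit-hodgefound`
(Track 2 foundations library), prover seat p15 generation 50, row g50-#2.  ALL the tree's renderings of
Shimura 1972 §3 so far (g48-#1 … g50-#1) are for the PRINCIPAL type (`hδ : ∀ i, 0 < (1 : Fin g → ℕ) i`,
`X_Z = ℂ^g/(Z, 1)ℤ^{2g}`), i.e. statement (II) of the Introduction.  Shimura proves Theorem 2 for every
polarization type satisfying his condition **(5)** «each invariant factor of `δ` occurs with an even
multiplicity», i.e. `δ = (d 0; 0 d)`, for which `j = (0 −1_m; 1_m 0)` COMMUTES with `Δ = diag(δ)`; THIS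
FILE carries Prop. 10 and Prop. 12 over to the tree's Siegel torus OF TYPE `δ`,
`X_Z^δ = ℂ^g/(Z, Δ)ℤ^{2g}` (`siegelPeriodEquiv hδ hZ` with an arbitrary type `hδ : ∀ i, 0 < δ i`) and
its Riemann form `E_Z^δ` of type `δ` (`siegelForm hδ hZ`, Gram matrix `E_δ = (0 Δ; −Δ 0)`), under the
hypothesis `jΔ = Δj` — which is exactly what condition (5) provides (`blockJ_mul_blockDiagonal_comm`).
THEOREMS ONLY: no definition, no instance, no notation, no named fact (net Literature debt `0`), no
`sorry`.

## Source, VERBATIM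

G. Shimura, *On the field of rationality for an abelian variety*, Nagoya Math. J. **45** (1972) 167–178,
held `paper:doi-10-1017-s0027763000014720`, §3 «The even dimensional case», pp. 173–176:
«Let `δ` be a diagonal matrix of degree `n` whose diagonal elements are non-zero rational integers …
For each `z ∈ 𝔖_n`, we consider an `(n × 2n)`-matrix `Ω(z) = (z δ)` and a lattice `L(z)` in `ℂⁿ`
generated by the column vectors of `Ω(z)`. … we obtain a Riemann form `Φ_z` on it by
`Φ_z(Ω(z)x, Ω(z)y) = ᵗxΔy`, `Δ = (0 −δ; δ 0)` … call it `P_z = (A_z, W_z)`.»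
«Now we assume that `n` is even, and put `n = 2m`.  Furthermore we consider the following condition on
the type of polarization. **(5)** Each invariant factor of `δ` occurs with an even multiplicity.  In
other words, there exist two elements `α` and `β` of `GL_n(ℤ)` such that `αδβ = (d 0; 0 d)` with a
diagonal matrix `d` of size `m`.  If this is satisfied, we may assume … that `δ` itself is of the form
`(d 0; 0 d)`.»
«**PROPOSITION 10.** Suppose that `δ = (d 0; 0 d)` with a diagonal matrix `d` of size `m`.  Let
`j = (0 −1_m; 1_m 0)`, and let `𝔜` be the set of all `z ∈ 𝔖_n` such that `jz = −z^ρ j`.  Then, for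
every `z ∈ 𝔜`, there is an isomorphism `λ` of `P_z` onto `P_z^ρ` such that `λ^ρ ∘ λ = −1`. … Proof. …
Suppose `z ∈ 𝔜`.  Then `jΩ(z) = Ω(−z^ρ)J′`, `J′ = (j 0; 0 j)`.  Since `L(z)^ρ = L(−z^ρ)`, the
automorphism of `ℂⁿ` obtained from `j` gives an isomorphism of `ℂⁿ/L(z)` onto `ℂⁿ/L(z)^ρ`. … so that
`λ^ρ(λ(f(u))) = λ^ρ(f′(ju)) = f(j²u) = −f(u)`, hence `λ^ρ ∘ λ = −1`. … Since `jΩ(z) = Ω(−z^ρ)J′` and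
`ᵗJ′ΔJ′ = Δ`, we see that `λ` sends `W_z` onto `W_z^ρ`, q.e.d.»
«**PROPOSITION 12.** If `P_z`, with `z ∈ 𝔜`, has no automorphisms other than `±1`, then `P_z` has no
model rational over its field of moduli.  Proof. Since `P_z` is isomorphic to `P_z^ρ`, the field of
moduli of `P_z` is contained in `ℝ`.  Assume that `P_z` has a model `P` rational over `ℝ`, and let `μ` be
an isomorphism of `P` onto `P_z`.  Then `λ⁻¹ ∘ μ^ρ ∘ μ⁻¹`, with `λ` as in Prop. 10, is an automorphism of
`P_z`, so that `λ⁻¹ ∘ μ^ρ ∘ μ⁻¹ = ±1`, hence `λ = ±μ^ρ ∘ μ⁻¹`.  But this contradicts the equality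
`λ^ρ ∘ λ = −1`.»

## The tree's rendering (type `δ`, `X_Z^δ = ℂ^g/(Z, Δ)ℤ^{2g}`, `𝔜_j = {Z ∈ 𝔥_g : jZ = −Z̄j}`)

As in g48-#1/#5 (principal type), with an arbitrary type `δ` (`hδ : ∀ i, 0 < δ i`) and an integral `j`
with `jΔ = Δj` (`Δ = diagonal δ`); «model over `ℝ`» is rendered by `RealStructure`, «`P_z ≅ P_z^ρ`» by an
`IsPolarizedIso` onto the conjugate point `−Z̄`, «no automorphisms other than `±1`» by the stronger
`End(X_Z^δ)^* = {±1}` (every holomorphic `ρ(P)` with `P` invertible over `ℤ` is `±1`).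

* **§1 «`jΩ(z) = Ω(−z^ρ)J′`» for `Ω(z) = (z δ)`**: `j_ℂ (Z, Δ) = (Z′, Δ)(j ⊕ j)` when `j_ℂ Z = Z′ j_ℂ` and
  `jΔ = Δj` (`map_intCast_mul_siegelPeriodMatrix_of_comm`); hence `Φ^δ_{Z′}((j ⊕ j)v) = j Φ^δ_Z(v)`
  (`siegelPeriodEquiv_blockDiag_mulVec_of_comm`), `ρ(j ⊕ j)` is holomorphic
  (`blockDiag_mulVec_latticeJ_of_comm`) and covers `u ↦ ju` (`mapMatrix_blockDiag_cover_of_comm`).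
* **§2 «`L(z)^ρ = L(−z^ρ)`» in type `δ`**: `Φ^δ_{−Z̄}(K v) = \overline{Φ^δ_Z(v)}`, `K = (−1) ⊕ 1`
  (`siegelPeriodEquiv_conjK_mulVec_of_type`), so `K` anti-commutes with the complex structures
  (`conjK_mulVec_latticeJ_eq_neg_of_type`) and `X^δ_{−Z̄}` is isomorphic to every conjugate presentation
  of `X^δ_Z` (`isIsomorphic_conj_presentation_of_type`).
* **§3 Prop. 10 in type `δ`**: «`ᵗJ′ΔJ′ = Δ`» — `ᵗ(j ⊕ j) E_δ (j ⊕ j) = E_δ` when `ᵗj j = 1`, `jΔ = Δj`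
  (`transpose_blockDiag_mul_typeForm_mul_blockDiag_of_comm`); **`λ = ρ(j ⊕ j)` is an isomorphism of
  polarized tori `(X^δ_Z, E^δ_Z) ⥲ (X^δ_{Z′}, E^δ_{Z′})`** (`exists_isPolarizedIso_blockDiag_of_comm`);
  «`λ^ρ ∘ λ = −1`» is the matrix identity `(j ⊕ j)² = −1` (g48-#1 `blockDiag_mul_blockDiag`, with
  `mapMatrix_mapMatrix`; recorded in the summary of §5).
* **§4 `τ = σ⁻¹ ∘ λ = ρ((−j) ⊕ j)`** is an anti-holomorphic self-map of `X^δ_Z` (with `τ ∘ τ = −id` by g48-#1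
  `negBlockDiag_mul_negBlockDiag`) reversing `E^δ_Z` (`mapMatrix_negBlockDiag_cover_of_comm`,
  `negBlockDiag_mulVec_latticeJ_eq_neg_of_comm`, `isAntiholomorphic_mapMatrix_negBlockDiag_of_comm`,
  `transpose_negBlockDiag_mul_typeForm_mul_negBlockDiag_of_comm`).
* **§5 Prop. 12 in type `δ`**: `Z ∈ 𝔜_j`, `j² = −1`, `jΔ = Δj`, `End(X^δ_Z)^* = {±1}` ⟹ `X^δ_Z ≅ X^δ_{−Z̄}`
  and every conjugate presentation, yet `IsEmpty (RealStructure X^δ_Z)`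
  (`isEmpty_realStructure_of_blockRel_of_comm`, via g48-#4 `isEmpty_realStructure_of_mul_self_eq_neg_one`),
  and every anti-holomorphic lattice automorphism squares to `−1`
  (`forall_mul_self_eq_neg_one_of_blockRel_of_comm`); summary
  `exists_isPolarizedIso_conj_and_isEmpty_realStructure_of_comm`.
* **§6 Condition (5)**: Shimura's `j₀ = (0 −1_m; 1_m 0)` commutes with `Δ = diag(d, d)`
  (`blockJ_mul_blockDiagonal_comm`), so all of the above applies to `δ = (d, d)` with `j = j₀`
  (`exists_isPolarizedIso_conj_and_isEmpty_realStructure_typeFive`).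
-/

noncomputable section

open scoped Manifold Matrix ComplexConjugate
open Matrix Complex Function

namespace Literature.AlgebraicGeometry.ModuliOfAbelianVarieties

namespace SiegelModuli

open Literature.NumberTheory.Automorphic (siegelUpperHalfSpace)
open Literature.Geometry.Kaehler Literature.Geometry.Kaehler.ComplexTorus

variable {g : ℕ}

/-! ## §0 Casting -/

/-- `(P Q)_R = P_R Q_R`. [folklore] -/
private theorem map_intCast_mul_g50b {R : Type*} [NonAssocRing R] {m n o : Type*} [Fintype n]
    (P : Matrix m n ℤ) (Q : Matrix n o ℤ) :
    (P * Q).map (Int.cast : ℤ → R) = P.map (Int.cast : ℤ → R) * Q.map (Int.cast : ℤ → R) := by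
  ext i j
  simp [Matrix.mul_apply]

/-- The integer diagonal `Δ = diag(δ)` cast to `ℂ` is the complex diagonal of `δ`. [folklore] -/
private theorem diagonal_natCast_map_g50b (δ : Fin g → ℕ) :
    (Matrix.diagonal fun i ↦ (δ i : ℤ)).map (Int.cast : ℤ → ℂ) = Matrix.diagonal fun i ↦ (δ i : ℂ) := by
  rw [Matrix.diagonal_map (Int.cast_zero)]
  simp

/-- The real extension of `K = (−1 0; 0 1)`. [folklore] -/
private theorem conjK_map_g50b :
    (Matrix.fromBlocks (-1 : Matrix (Fin g) (Fin g) ℤ) 0 0 (1 : Matrix (Fin g) (Fin g) ℤ)).map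
        (Int.cast : ℤ → ℝ) =
      Matrix.fromBlocks (-1 : Matrix (Fin g) (Fin g) ℝ) 0 0 (1 : Matrix (Fin g) (Fin g) ℝ) := by
  ext (i | i) (j | j) <;> simp [Matrix.one_apply, apply_ite (Int.cast : ℤ → ℝ)]

/-- `(K v)_{λ_k} = −v_{λ_k}`. [folklore] -/
private theorem conjK_mulVec_inl_g50b (v : Fin g ⊕ Fin g → ℝ) (k : Fin g) :
    (((Matrix.fromBlocks (-1 : Matrix (Fin g) (Fin g) ℤ) 0 0 (1 : Matrix (Fin g) (Fin g) ℤ)).map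
        (Int.cast : ℤ → ℝ)) *ᵥ v) (Sum.inl k) = -v (Sum.inl k) := by
  rw [conjK_map_g50b, Matrix.fromBlocks_mulVec, Sum.elim_inl, Matrix.zero_mulVec, add_zero,
    Matrix.neg_mulVec, Matrix.one_mulVec]
  rfl

/-- `(K v)_{μ_k} = v_{μ_k}`. [folklore] -/
private theorem conjK_mulVec_inr_g50b (v : Fin g ⊕ Fin g → ℝ) (k : Fin g) :
    (((Matrix.fromBlocks (-1 : Matrix (Fin g) (Fin g) ℤ) 0 0 (1 : Matrix (Fin g) (Fin g) ℤ)).map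
        (Int.cast : ℤ → ℝ)) *ᵥ v) (Sum.inr k) = v (Sum.inr k) := by
  rw [conjK_map_g50b, Matrix.fromBlocks_mulVec, Sum.elim_inr, Matrix.zero_mulVec, zero_add,
    Matrix.one_mulVec]
  rfl

/-- `(ᵗj ⊕ ᵗj)(j ⊕ j) = 1` when `ᵗj j = 1`. [folklore] -/
private theorem blockDiag_transpose_mul_blockDiag_g50b {j : Matrix (Fin g) (Fin g) ℤ} (hjT : jᵀ * j = 1) :
    Matrix.fromBlocks jᵀ 0 0 jᵀ * Matrix.fromBlocks j 0 0 j = 1 := by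
  rw [Matrix.fromBlocks_multiply, ← Matrix.fromBlocks_one]
  simp [hjT]

/-- `(j ⊕ j)(ᵗj ⊕ ᵗj) = 1` when `ᵗj j = 1`. [folklore] -/
private theorem blockDiag_mul_blockDiag_transpose_g50b {j : Matrix (Fin g) (Fin g) ℤ} (hjT : jᵀ * j = 1) :
    Matrix.fromBlocks j 0 0 j * Matrix.fromBlocks jᵀ 0 0 jᵀ = 1 := by
  have hjjT : j * jᵀ = 1 := mul_eq_one_comm.1 hjT
  rw [Matrix.fromBlocks_multiply, ← Matrix.fromBlocks_one]
  simp [hjjT]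

/-! ## §1 «`jΩ(z) = Ω(−z^ρ)J′`» for the period matrix `Ω(z) = (z δ)` of type `δ`, when `jΔ = Δj` -/

section Lambda

variable {δ : Fin g → ℕ} (hδ : ∀ i, 0 < δ i) {Z Z' : Matrix (Fin g) (Fin g) ℂ}
  (hZ : Z ∈ siegelUpperHalfSpace g) (hZ' : Z' ∈ siegelUpperHalfSpace g) (j : Matrix (Fin g) (Fin g) ℤ)

/-- **«`jΩ(z) = Ω(−z^ρ)J′`, `J′ = (j 0; 0 j)`» in type `δ`**: if `j_ℂ Z = Z′ j_ℂ` (for `Z′ = −Z̄`: the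
relation `jz = −z^ρ j` of `𝔜`) and `jΔ = Δj` (condition (5)), then `j (Z, Δ) = (Z′, Δ)(j ⊕ j)`.
[cite: Shimura1972FieldOfRationality, §3 Prop. 10 proof, pp. 174–175] -/
theorem map_intCast_mul_siegelPeriodMatrix_of_comm
    (hjZ : j.map (Int.cast : ℤ → ℂ) * Z = Z' * j.map (Int.cast : ℤ → ℂ))
    (hjΔ : j * Matrix.diagonal (fun i ↦ (δ i : ℤ)) = Matrix.diagonal (fun i ↦ (δ i : ℤ)) * j) :
    j.map (Int.cast : ℤ → ℂ) * siegelPeriodMatrix δ Z =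
      siegelPeriodMatrix δ Z' * (Matrix.fromBlocks j 0 0 j).map (Int.cast : ℤ → ℂ) := by
  have hΔ : j.map (Int.cast : ℤ → ℂ) * Matrix.diagonal (fun i ↦ (δ i : ℂ)) =
      Matrix.diagonal (fun i ↦ (δ i : ℂ)) * j.map (Int.cast : ℤ → ℂ) := by
    have h := congrArg (fun M : Matrix (Fin g) (Fin g) ℤ ↦ M.map (Int.cast : ℤ → ℂ)) hjΔ
    simpa only [map_intCast_mul_g50b, diagonal_natCast_map_g50b] using h
  have h0 : (0 : Matrix (Fin g) (Fin g) ℤ).map (Int.cast : ℤ → ℂ) = 0 := by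
    ext i k
    simp
  rw [siegelPeriodMatrix, siegelPeriodMatrix, Matrix.fromBlocks_map, h0, Matrix.mul_fromCols,
    Matrix.fromCols_mul_fromBlocks, hjZ, hΔ]
  simp only [Matrix.mul_zero, add_zero, zero_add]

/-- **`Φ^δ_{Z′}((j ⊕ j)v) = j · Φ^δ_Z(v)`**: the analytic representation of `ρ(j ⊕ j) : X^δ_Z → X^δ_{Z′}`
is `u ↦ ju` («the automorphism of `ℂⁿ` obtained from `j`»), for `j_ℂ Z = Z′ j_ℂ` and `jΔ = Δj`.
[cite: Shimura1972FieldOfRationality, §3 Prop. 10 proof, pp. 174–175] -/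
theorem siegelPeriodEquiv_blockDiag_mulVec_of_comm
    (hjZ : j.map (Int.cast : ℤ → ℂ) * Z = Z' * j.map (Int.cast : ℤ → ℂ))
    (hjΔ : j * Matrix.diagonal (fun i ↦ (δ i : ℤ)) = Matrix.diagonal (fun i ↦ (δ i : ℤ)) * j)
    (v : Fin g ⊕ Fin g → ℝ) :
    siegelPeriodEquiv hδ hZ' (((Matrix.fromBlocks j 0 0 j).map (Int.cast : ℤ → ℝ)) *ᵥ v) =
      j.map (Int.cast : ℤ → ℂ) *ᵥ siegelPeriodEquiv hδ hZ v := by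
  have h := (rel_iff_matrix δ Z Z' (Matrix.toLin' (j.map (Int.cast : ℤ → ℂ)))
    (Matrix.fromBlocks j 0 0 j)).2
    (by rw [LinearMap.toMatrix'_toLin']; exact map_intCast_mul_siegelPeriodMatrix_of_comm j hjZ hjΔ) v
  rw [siegelPeriodEquiv_apply, siegelPeriodEquiv_apply, ← h, Matrix.toLin'_apply]

/-- **`(j ⊕ j)_ℝ J^δ_Z = J^δ_{Z′} (j ⊕ j)_ℝ`**: `ρ(j ⊕ j) : X^δ_Z → X^δ_{Z′}` is holomorphic (its analytic
representation `u ↦ ju` is `ℂ`-linear). [cite: Shimura1972FieldOfRationality, §3 Prop. 10 proof, pp. 174–175] -/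
theorem blockDiag_mulVec_latticeJ_of_comm
    (hjZ : j.map (Int.cast : ℤ → ℂ) * Z = Z' * j.map (Int.cast : ℤ → ℂ))
    (hjΔ : j * Matrix.diagonal (fun i ↦ (δ i : ℤ)) = Matrix.diagonal (fun i ↦ (δ i : ℤ)) * j)
    (y : Fin g ⊕ Fin g → ℝ) :
    ((Matrix.fromBlocks j 0 0 j).map (Int.cast : ℤ → ℝ)) *ᵥ latticeJ (siegelPeriodEquiv hδ hZ) y =
      latticeJ (siegelPeriodEquiv hδ hZ') (((Matrix.fromBlocks j 0 0 j).map (Int.cast : ℤ → ℝ)) *ᵥ y) :=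
  (siegelPeriodEquiv hδ hZ').injective (by
    rw [apply_latticeJ, siegelPeriodEquiv_blockDiag_mulVec_of_comm hδ hZ hZ' j hjZ hjΔ,
      siegelPeriodEquiv_blockDiag_mulVec_of_comm hδ hZ hZ' j hjZ hjΔ, apply_latticeJ, Matrix.mulVec_smul])

/-- The real analytic representation of `ρ(j ⊕ j) : X^δ_Z → X^δ_{Z′}` is `u ↦ ju`.
[cite: Shimura1972FieldOfRationality, §3 Prop. 10 proof, p. 175] -/
theorem realRep_blockDiag_eq_mulVec_of_comm
    (hjZ : j.map (Int.cast : ℤ → ℂ) * Z = Z' * j.map (Int.cast : ℤ → ℂ))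
    (hjΔ : j * Matrix.diagonal (fun i ↦ (δ i : ℤ)) = Matrix.diagonal (fun i ↦ (δ i : ℤ)) * j)
    (z : Fin g → ℂ) :
    realRep (siegelPeriodEquiv hδ hZ) (siegelPeriodEquiv hδ hZ') (Matrix.fromBlocks j 0 0 j) z =
      j.map (Int.cast : ℤ → ℂ) *ᵥ z := by
  obtain ⟨v, rfl⟩ := (siegelPeriodEquiv hδ hZ).surjective z
  rw [realRep_apply, siegelPeriodEquiv_blockDiag_mulVec_of_comm hδ hZ hZ' j hjZ hjΔ]

/-- **«`λ(f(u)) = f′(ju)`» in type `δ`**: `ρ(j ⊕ j)(π_Z u) = π_{Z′}(ju)`.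
[cite: Shimura1972FieldOfRationality, §3 Prop. 10 proof, p. 175] -/
theorem mapMatrix_blockDiag_cover_of_comm
    (hjZ : j.map (Int.cast : ℤ → ℂ) * Z = Z' * j.map (Int.cast : ℤ → ℂ))
    (hjΔ : j * Matrix.diagonal (fun i ↦ (δ i : ℤ)) = Matrix.diagonal (fun i ↦ (δ i : ℤ)) * j)
    (z : Fin g → ℂ) :
    mapMatrix (siegelPeriodEquiv hδ hZ) (siegelPeriodEquiv hδ hZ') (Matrix.fromBlocks j 0 0 j)
        (cover (siegelPeriodEquiv hδ hZ) z) =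
      cover (siegelPeriodEquiv hδ hZ') (j.map (Int.cast : ℤ → ℂ) *ᵥ z) := by
  rw [mapMatrix_cover, realRep_blockDiag_eq_mulVec_of_comm hδ hZ hZ' j hjZ hjΔ]

/-- **`X^δ_Z ≅ X^δ_{Z′}` as complex tori** via `ρ(j ⊕ j)` with inverse `ρ(j′ ⊕ j′)` (`jj′ = j′j = 1`),
for `j_ℂ Z = Z′ j_ℂ` and `jΔ = Δj`. [cite: Shimura1972FieldOfRationality, §3 Prop. 10, pp. 174–175] -/
theorem isIsomorphic_blockDiag_of_comm {j' : Matrix (Fin g) (Fin g) ℤ} (hjj' : j * j' = 1) (hj'j : j' * j = 1)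
    (hjZ : j.map (Int.cast : ℤ → ℂ) * Z = Z' * j.map (Int.cast : ℤ → ℂ))
    (hjΔ : j * Matrix.diagonal (fun i ↦ (δ i : ℤ)) = Matrix.diagonal (fun i ↦ (δ i : ℤ)) * j) :
    IsIsomorphic (siegelPeriodEquiv hδ hZ) (siegelPeriodEquiv hδ hZ') :=
  isIsomorphic_of_latticeJ_comm (A := Matrix.fromBlocks j 0 0 j) (B := Matrix.fromBlocks j' 0 0 j')
    (by rw [Matrix.fromBlocks_multiply, ← Matrix.fromBlocks_one]; simp [hj'j])
    (by rw [Matrix.fromBlocks_multiply, ← Matrix.fromBlocks_one]; simp [hjj'])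
    (blockDiag_mulVec_latticeJ_of_comm hδ hZ hZ' j hjZ hjΔ)

end Lambda

/-! ## §2 «`L(z)^ρ = L(−z^ρ)`» in type `δ`: complex conjugation `ρ(K) : X^δ_Z → X^δ_{−Z̄}`, `K = (−1) ⊕ 1` -/

section Conj

variable {δ : Fin g → ℕ} (hδ : ∀ i, 0 < δ i) {Z Z' : Matrix (Fin g) (Fin g) ℂ}
  (hZ : Z ∈ siegelUpperHalfSpace g) (hZ' : Z' ∈ siegelUpperHalfSpace g)

/-- **Complex conjugation in the lattice coordinates of `X^δ_Z` and `X^δ_{−Z̄}`**: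
`\overline{Φ^δ_Z(x, y)} = \overline{Zx + Δy} = (−Z̄)(−x) + Δy = Φ^δ_{−Z̄}(K(x, y))`, `K = (−1 0; 0 1)`
(«`L(z)^ρ = L(−z^ρ)`»; g48-#1 `siegelPeriodEquiv_conjK_mulVec` is the principal case).
[cite: Shimura1972FieldOfRationality, §3 Prop. 10 proof, pp. 174–175] -/
theorem siegelPeriodEquiv_conjK_mulVec_of_type (hc : Z' = -Z.map conj) (v : Fin g ⊕ Fin g → ℝ) :
    siegelPeriodEquiv hδ hZ'
        (((Matrix.fromBlocks (-1 : Matrix (Fin g) (Fin g) ℤ) 0 0 (1 : Matrix (Fin g) (Fin g) ℤ)).map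
          (Int.cast : ℤ → ℝ)) *ᵥ v) =
      star (siegelPeriodEquiv hδ hZ v) := by
  funext i
  simp only [Pi.star_apply, siegelPeriodEquiv_apply, siegelPeriodMap_apply, conjK_mulVec_inr_g50b,
    conjK_mulVec_inl_g50b]
  rw [hc]
  simp only [Matrix.neg_apply, Matrix.map_apply, Complex.star_def, map_add, map_sum, map_mul,
    Complex.conj_ofReal, map_natCast, Complex.ofReal_neg, neg_mul_neg]

/-- **`K J^δ_Z = −J^δ_{−Z̄} K`**: complex conjugation anti-commutes with the complex structures of the
lattices of `X^δ_Z` and `X^δ_{−Z̄}` (its analytic representation `u ↦ ū` is conjugate-linear).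
[cite: Shimura1972FieldOfRationality, §3 Prop. 10 proof, pp. 174–175] [cite: deGaayFortman2022, Lemma 2.2] -/
theorem conjK_mulVec_latticeJ_eq_neg_of_type (hc : Z' = -Z.map conj) (x : Fin g ⊕ Fin g → ℝ) :
    ((Matrix.fromBlocks (-1 : Matrix (Fin g) (Fin g) ℤ) 0 0 (1 : Matrix (Fin g) (Fin g) ℤ)).map
        (Int.cast : ℤ → ℝ)) *ᵥ latticeJ (siegelPeriodEquiv hδ hZ) x =
      -latticeJ (siegelPeriodEquiv hδ hZ')
        (((Matrix.fromBlocks (-1 : Matrix (Fin g) (Fin g) ℤ) 0 0 (1 : Matrix (Fin g) (Fin g) ℤ)).map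
          (Int.cast : ℤ → ℝ)) *ᵥ x) :=
  mulVec_latticeJ_eq_neg_of_conjLinear
    (σ := ((starL ℂ : (Fin g → ℂ) ≃L⋆[ℂ] (Fin g → ℂ)) : (Fin g → ℂ) →L⋆[ℂ] (Fin g → ℂ)))
    (fun v ↦ by
      rw [siegelPeriodEquiv_conjK_mulVec_of_type hδ hZ hZ' hc]
      simp) x

/-- **`σ = ρ(K) : X^δ_Z → X^δ_{−Z̄}` is anti-holomorphic** (the canonical map `X → X^σ`).
[cite: Silhol1989, Ch. I (1.1)–(1.3), pp. 2–3] [cite: Shimura1972FieldOfRationality, §3 Prop. 10 proof, pp. 174–175] -/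
theorem isAntiholomorphic_mapMatrix_conjK_of_type (hc : Z' = -Z.map conj) :
    IsAntiholomorphic 𝓘(ℂ, Fin g → ℂ) 𝓘(ℂ, Fin g → ℂ)
      (mapMatrix (siegelPeriodEquiv hδ hZ) (siegelPeriodEquiv hδ hZ')
        (Matrix.fromBlocks (-1 : Matrix (Fin g) (Fin g) ℤ) 0 0 (1 : Matrix (Fin g) (Fin g) ℤ))) :=
  (isAntiholomorphic_mapMatrix_iff _).2 (conjK_mulVec_latticeJ_eq_neg_of_type hδ hZ hZ' hc)

/-- **`X^δ_{−Z̄}` is THE conjugate torus of `X^δ_Z`**: every conjugate presentation `Ψc` of `X^δ_Z`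
(same lattice coordinates, `J_{Ψc} = −J^δ_Z`) is isomorphic to `X^δ_{−Z̄}` via `ρ(K)`.
[cite: Shimura1972FieldOfRationality, §3 Prop. 10 proof («`A_z^ρ`, … `ℂⁿ/L(z)^ρ`»), p. 175] [cite: Lange2023AbelianVarietiesComplex, §5.4.4 Example 5.4.17] -/
theorem isIsomorphic_conj_presentation_of_type (hc : Z' = -Z.map conj)
    {Ec : Type*} [NormedAddCommGroup Ec] [NormedSpace ℂ Ec] {Ψc : (Fin g ⊕ Fin g → ℝ) ≃L[ℝ] Ec}
    (hΨ : ∀ y, latticeJ Ψc y = -latticeJ (siegelPeriodEquiv hδ hZ) y) :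
    IsIsomorphic Ψc (siegelPeriodEquiv hδ hZ') :=
  isIsomorphic_of_latticeJ_comm
    (A := Matrix.fromBlocks (-1 : Matrix (Fin g) (Fin g) ℤ) 0 0 (1 : Matrix (Fin g) (Fin g) ℤ))
    (B := Matrix.fromBlocks (-1 : Matrix (Fin g) (Fin g) ℤ) 0 0 (1 : Matrix (Fin g) (Fin g) ℤ))
    conjK_mul_conjK conjK_mul_conjK fun x ↦ by
      rw [hΨ, Matrix.mulVec_neg, conjK_mulVec_latticeJ_eq_neg_of_type hδ hZ hZ' hc, neg_neg]

end Conj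

/-! ## §3 Prop. 10 in type `δ`: `λ = ρ(j ⊕ j) : (X^δ_Z, E^δ_Z) ⥲ (X^δ_{Z′}, E^δ_{Z′})`, «`ᵗJ′ΔJ′ = Δ`»,
«`λ^ρ ∘ λ = −1`» -/

section PropTen

variable {δ : Fin g → ℕ} (hδ : ∀ i, 0 < δ i) {Z Z' : Matrix (Fin g) (Fin g) ℂ}
  (hZ : Z ∈ siegelUpperHalfSpace g) (hZ' : Z' ∈ siegelUpperHalfSpace g) (j : Matrix (Fin g) (Fin g) ℤ)

/-- **«`ᵗJ′ΔJ′ = Δ`» in type `δ`**: `ᵗ(j ⊕ j) E_δ (j ⊕ j) = E_δ` for `E_δ = (0 Δ; −Δ 0)` when `ᵗj j = 1`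
and `jΔ = Δj` (then `ᵗjΔj = ᵗj jΔ = Δ`). [cite: Shimura1972FieldOfRationality, §3 Prop. 10 proof («`ᵗJ′ΔJ′ = Δ`»), p. 175] -/
theorem transpose_blockDiag_mul_typeForm_mul_blockDiag_of_comm (hjT : jᵀ * j = 1)
    (hjΔ : j * Matrix.diagonal (fun i ↦ (δ i : ℤ)) = Matrix.diagonal (fun i ↦ (δ i : ℤ)) * j) :
    (Matrix.fromBlocks j 0 0 j)ᵀ * typeForm δ * Matrix.fromBlocks j 0 0 j = typeForm δ := by
  have h1 : jᵀ * (Matrix.diagonal (fun i ↦ (δ i : ℤ)) * j) = Matrix.diagonal (fun i ↦ (δ i : ℤ)) := by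
    rw [← hjΔ, ← Matrix.mul_assoc, hjT, Matrix.one_mul]
  rw [typeForm, Matrix.fromBlocks_transpose, Matrix.fromBlocks_multiply, Matrix.fromBlocks_multiply]
  simp only [Matrix.transpose_zero, Matrix.mul_zero, Matrix.zero_mul, add_zero, zero_add, Matrix.mul_neg,
    Matrix.neg_mul, Matrix.mul_assoc, h1, neg_zero]

/-- **Shimura's Prop. 10 in type `δ` — the isomorphism `λ : P_z ⥲ P_z^ρ`.**  For a type `δ`, `Z, Z′ ∈ 𝔥_g`
and an integer matrix `j` with `ᵗj j = 1`, `jΔ = Δj` and `j_ℂ Z = Z′ j_ℂ` (for the conjugate point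
`Z′ = −Z̄` this is `jz = −z^ρ j`, the relation defining `𝔜`), `λ = ρ(j ⊕ j)` is an ISOMORPHISM OF
POLARIZED TORI `(X^δ_Z, E^δ_Z) ⥲ (X^δ_{Z′}, E^δ_{Z′})` covering `u ↦ ju` («the automorphism of `ℂⁿ` obtained
from `j` gives an isomorphism of `ℂⁿ/L(z)` onto `ℂⁿ/L(z)^ρ` … Since `jΩ(z) = Ω(−z^ρ)J′` and `ᵗJ′ΔJ′ = Δ`,
we see that `λ` sends `W_z` onto `W_z^ρ`»; g48-#1 `exists_isPolarizedIso_blockDiag` is the principal case).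
[cite: Shimura1972FieldOfRationality, §3 Prop. 10, pp. 174–175] -/
theorem exists_isPolarizedIso_blockDiag_of_comm (hjT : jᵀ * j = 1)
    (hjZ : j.map (Int.cast : ℤ → ℂ) * Z = Z' * j.map (Int.cast : ℤ → ℂ))
    (hjΔ : j * Matrix.diagonal (fun i ↦ (δ i : ℤ)) = Matrix.diagonal (fun i ↦ (δ i : ℤ)) * j) :
    ∃ h : ComplexTorus (siegelPeriodEquiv hδ hZ) ≃+ ComplexTorus (siegelPeriodEquiv hδ hZ'),
      IsPolarizedIso (siegelPeriodEquiv hδ hZ) (siegelForm hδ hZ) (siegelPeriodEquiv hδ hZ')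
          (siegelForm hδ hZ') h ∧
        ⇑h = mapMatrix (siegelPeriodEquiv hδ hZ) (siegelPeriodEquiv hδ hZ') (Matrix.fromBlocks j 0 0 j) ∧
        ∀ z, h (cover (siegelPeriodEquiv hδ hZ) z) =
          cover (siegelPeriodEquiv hδ hZ') (j.map (Int.cast : ℤ → ℂ) *ᵥ z) := by
  set C : (Fin g → ℂ) →L[ℂ] (Fin g → ℂ) :=
    LinearMap.toContinuousLinearMap (Matrix.toLin' (j.map (Int.cast : ℤ → ℂ))) with hCdef
  have hCapp : ∀ w, C w = j.map (Int.cast : ℤ → ℂ) *ᵥ w := fun w ↦ by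
    rw [hCdef, LinearMap.coe_toContinuousLinearMap', Matrix.toLin'_apply]
  have hC : ∀ x, siegelPeriodEquiv hδ hZ' (((Matrix.fromBlocks j 0 0 j).map (Int.cast : ℤ → ℝ)) *ᵥ x) =
      C (siegelPeriodEquiv hδ hZ x) := fun x ↦ by
    rw [hCapp, siegelPeriodEquiv_blockDiag_mulVec_of_comm hδ hZ hZ' j hjZ hjΔ]
  have hη : ∀ u v : Fin g → ℂ,
      siegelForm hδ hZ' ![C u, C v] = siegelForm hδ hZ ![u, v] := fun u v ↦ by
    obtain ⟨x, rfl⟩ := (siegelPeriodEquiv hδ hZ).surjective u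
    obtain ⟨y, rfl⟩ := (siegelPeriodEquiv hδ hZ).surjective v
    rw [← hC, ← hC]
    exact (forall_siegelForm_mulVec_eq_iff hδ hZ hZ' (Matrix.fromBlocks j 0 0 j)).2
      (transpose_blockDiag_mul_typeForm_mul_blockDiag_of_comm j hjT hjΔ) x y
  obtain ⟨h, hh, hcoe, -⟩ := exists_isPolarizedIso_of_matrix (blockDiag_transpose_mul_blockDiag_g50b hjT)
    (blockDiag_mul_blockDiag_transpose_g50b hjT) C hC hη
  exact ⟨h, hh, hcoe, fun z ↦ by rw [hcoe, mapMatrix_blockDiag_cover_of_comm hδ hZ hZ' j hjZ hjΔ]⟩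

end PropTen

/-! ## §4 `τ = σ⁻¹ ∘ λ = ρ((−j) ⊕ j)`: an anti-holomorphic self-map of `X^δ_Z` reversing `E^δ_Z` -/

section Tau

variable {δ : Fin g → ℕ} (hδ : ∀ i, 0 < δ i) {Z : Matrix (Fin g) (Fin g) ℂ}
  (hZ : Z ∈ siegelUpperHalfSpace g) (j : Matrix (Fin g) (Fin g) ℤ)

/-- **`τ = ρ((−j) ⊕ j)` covers `u ↦ \overline{ju}`** on `X^δ_Z` when `jZ = −Z̄j`, `jΔ = Δj`: `τ = σ⁻¹ ∘ λ`
with `λ = ρ(j ⊕ j)` covering `u ↦ ju` and `σ⁻¹ = ρ(K) : X^δ_{−Z̄} → X^δ_Z` covering `u ↦ ū`.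
[cite: Shimura1972FieldOfRationality, §3 Prop. 10 and Prop. 12 proofs, pp. 175–176] -/
theorem mapMatrix_negBlockDiag_cover_of_comm
    (hjZ : j.map (Int.cast : ℤ → ℂ) * Z = -Z.map conj * j.map (Int.cast : ℤ → ℂ))
    (hjΔ : j * Matrix.diagonal (fun i ↦ (δ i : ℤ)) = Matrix.diagonal (fun i ↦ (δ i : ℤ)) * j)
    (z : Fin g → ℂ) :
    mapMatrix (siegelPeriodEquiv hδ hZ) (siegelPeriodEquiv hδ hZ) (Matrix.fromBlocks (-j) 0 0 j)
        (cover (siegelPeriodEquiv hδ hZ) z) =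
      cover (siegelPeriodEquiv hδ hZ) (star (j.map (Int.cast : ℤ → ℂ) *ᵥ z)) := by
  have hZ' := neg_map_conj_mem_siegelUpperHalfSpace hZ
  have hc' : Z = -(-Z.map conj).map conj := (neg_map_conj_neg_map_conj Z).symm
  have hσ : ∀ w : Fin g → ℂ,
      mapMatrix (siegelPeriodEquiv hδ hZ') (siegelPeriodEquiv hδ hZ)
          (Matrix.fromBlocks (-1 : Matrix (Fin g) (Fin g) ℤ) 0 0 (1 : Matrix (Fin g) (Fin g) ℤ))
          (cover (siegelPeriodEquiv hδ hZ') w) =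
        cover (siegelPeriodEquiv hδ hZ) (star w) := fun w ↦ by
    obtain ⟨v, rfl⟩ := (siegelPeriodEquiv hδ hZ').surjective w
    rw [mapMatrix_cover, realRep_apply, siegelPeriodEquiv_conjK_mulVec_of_type hδ hZ' hZ hc']
  rw [← conjK_mul_blockDiag, ← mapMatrix_mapMatrix (Φ' := siegelPeriodEquiv hδ hZ'),
    mapMatrix_blockDiag_cover_of_comm hδ hZ hZ' j hjZ hjΔ, hσ]

/-- **`((−j) ⊕ j)_ℝ J^δ_Z = −J^δ_Z ((−j) ⊕ j)_ℝ`** when `jZ = −Z̄j`, `jΔ = Δj`: `τ` is anti-holomorphic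
(composite of the holomorphic `λ` and the anti-holomorphic `σ⁻¹`).
[cite: Shimura1972FieldOfRationality, §3 Prop. 10 proof, p. 175] [cite: deGaayFortman2022, Lemma 2.2] -/
theorem negBlockDiag_mulVec_latticeJ_eq_neg_of_comm
    (hjZ : j.map (Int.cast : ℤ → ℂ) * Z = -Z.map conj * j.map (Int.cast : ℤ → ℂ))
    (hjΔ : j * Matrix.diagonal (fun i ↦ (δ i : ℤ)) = Matrix.diagonal (fun i ↦ (δ i : ℤ)) * j)
    (x : Fin g ⊕ Fin g → ℝ) :
    ((Matrix.fromBlocks (-j) 0 0 j).map (Int.cast : ℤ → ℝ)) *ᵥ latticeJ (siegelPeriodEquiv hδ hZ) x =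
      -latticeJ (siegelPeriodEquiv hδ hZ)
        (((Matrix.fromBlocks (-j) 0 0 j).map (Int.cast : ℤ → ℝ)) *ᵥ x) := by
  have hZ' := neg_map_conj_mem_siegelUpperHalfSpace hZ
  have hc' : Z = -(-Z.map conj).map conj := (neg_map_conj_neg_map_conj Z).symm
  rw [← conjK_mul_blockDiag, map_intCast_mul_g50b, ← Matrix.mulVec_mulVec, ← Matrix.mulVec_mulVec,
    blockDiag_mulVec_latticeJ_of_comm hδ hZ hZ' j hjZ hjΔ, conjK_mulVec_latticeJ_eq_neg_of_type hδ hZ' hZ hc']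

/-- **`τ = ρ((−j) ⊕ j)` is an anti-holomorphic self-map of `X^δ_Z`** when `jZ = −Z̄j`, `jΔ = Δj`.
[cite: Shimura1972FieldOfRationality, §3 Prop. 10, pp. 174–175] [cite: deGaayFortman2022, Lemma 2.2] -/
theorem isAntiholomorphic_mapMatrix_negBlockDiag_of_comm
    (hjZ : j.map (Int.cast : ℤ → ℂ) * Z = -Z.map conj * j.map (Int.cast : ℤ → ℂ))
    (hjΔ : j * Matrix.diagonal (fun i ↦ (δ i : ℤ)) = Matrix.diagonal (fun i ↦ (δ i : ℤ)) * j) :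
    IsAntiholomorphic 𝓘(ℂ, Fin g → ℂ) 𝓘(ℂ, Fin g → ℂ)
      (mapMatrix (siegelPeriodEquiv hδ hZ) (siegelPeriodEquiv hδ hZ) (Matrix.fromBlocks (-j) 0 0 j)) :=
  (isAntiholomorphic_mapMatrix_iff _).2 (negBlockDiag_mulVec_latticeJ_eq_neg_of_comm hδ hZ j hjZ hjΔ)

/-- **`E^δ_Z(τu, τv) = −E^δ_Z(u, v)`** when `ᵗj j = 1`, `jΔ = Δj`: `τ` reverses the polarization of type `δ`
(`ᵗ((−j) ⊕ j) E_δ ((−j) ⊕ j) = −E_δ`). [cite: Shimura1972FieldOfRationality, §3 Prop. 10 proof, p. 175] [cite: Silhol1989, Ch. IV (3.3), p. 56] -/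
theorem transpose_negBlockDiag_mul_typeForm_mul_negBlockDiag_of_comm (hjT : jᵀ * j = 1)
    (hjΔ : j * Matrix.diagonal (fun i ↦ (δ i : ℤ)) = Matrix.diagonal (fun i ↦ (δ i : ℤ)) * j) :
    (Matrix.fromBlocks (-j) 0 0 j)ᵀ * typeForm δ * Matrix.fromBlocks (-j) 0 0 j = -typeForm δ := by
  rw [← conjK_mul_blockDiag, Matrix.transpose_mul]
  calc (Matrix.fromBlocks j 0 0 j)ᵀ *
          (Matrix.fromBlocks (-1 : Matrix (Fin g) (Fin g) ℤ) 0 0 (1 : Matrix (Fin g) (Fin g) ℤ))ᵀ * typeForm δ *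
          (Matrix.fromBlocks (-1 : Matrix (Fin g) (Fin g) ℤ) 0 0 (1 : Matrix (Fin g) (Fin g) ℤ) *
            Matrix.fromBlocks j 0 0 j)
        = (Matrix.fromBlocks j 0 0 j)ᵀ *
            ((Matrix.fromBlocks (-1 : Matrix (Fin g) (Fin g) ℤ) 0 0 (1 : Matrix (Fin g) (Fin g) ℤ))ᵀ * typeForm δ *
              Matrix.fromBlocks (-1 : Matrix (Fin g) (Fin g) ℤ) 0 0 (1 : Matrix (Fin g) (Fin g) ℤ)) *
            Matrix.fromBlocks j 0 0 j := by
          simp only [Matrix.mul_assoc]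
    _ = -typeForm δ := by
          rw [transpose_conjK_mul_typeForm_mul_conjK, Matrix.mul_neg, Matrix.neg_mul,
            transpose_blockDiag_mul_typeForm_mul_blockDiag_of_comm j hjT hjΔ]

end Tau

/-! ## §5 Prop. 12 in type `δ`: `Z ∈ 𝔜_j`, `jΔ = Δj` and `End(X^δ_Z)^* = {±1}` ⟹ no real structure -/

section PropTwelve

variable {δ : Fin g → ℕ} (hδ : ∀ i, 0 < δ i) {Z : Matrix (Fin g) (Fin g) ℂ}
  (hZ : Z ∈ siegelUpperHalfSpace g) (j : Matrix (Fin g) (Fin g) ℤ)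

/-- **`Z ∈ 𝔜_j` ⟹ `X^δ_Z ≅ X^δ_{−Z̄}` as complex tori** (`j² = −1`, `jZ = −Z̄j`, `jΔ = Δj`;
`(j ⊕ j)⁻¹ = −(j ⊕ j)`). [cite: Shimura1972FieldOfRationality, §3 Prop. 10, pp. 174–175] -/
theorem isIsomorphic_neg_conj_of_blockRel_of_comm (hjj : j * j = -1)
    (hjZ : j.map (Int.cast : ℤ → ℂ) * Z = -Z.map conj * j.map (Int.cast : ℤ → ℂ))
    (hjΔ : j * Matrix.diagonal (fun i ↦ (δ i : ℤ)) = Matrix.diagonal (fun i ↦ (δ i : ℤ)) * j) :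
    IsIsomorphic (siegelPeriodEquiv hδ hZ) (siegelPeriodEquiv hδ (neg_map_conj_mem_siegelUpperHalfSpace hZ)) :=
  isIsomorphic_blockDiag_of_comm hδ hZ (neg_map_conj_mem_siegelUpperHalfSpace hZ) j (j' := -j)
    (by rw [Matrix.mul_neg, hjj, neg_neg]) (by rw [Matrix.neg_mul, hjj, neg_neg]) hjZ hjΔ

/-- **`Z ∈ 𝔜_j` ⟹ `X^δ_Z ≅ X̄`** for every conjugate presentation `X̄` of `X^δ_Z`, via `X^δ_Z ≅ X^δ_{−Z̄} ≅ X̄`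
(«`P_z` is isomorphic to `P_z^ρ`»). [cite: Shimura1972FieldOfRationality, §3 Prop. 10 and Prop. 12 proof, pp. 174–176] -/
theorem isIsomorphic_conj_presentation_of_blockRel_of_comm (hjj : j * j = -1)
    (hjZ : j.map (Int.cast : ℤ → ℂ) * Z = -Z.map conj * j.map (Int.cast : ℤ → ℂ))
    (hjΔ : j * Matrix.diagonal (fun i ↦ (δ i : ℤ)) = Matrix.diagonal (fun i ↦ (δ i : ℤ)) * j)
    {Ec : Type*} [NormedAddCommGroup Ec] [NormedSpace ℂ Ec] {Ψc : (Fin g ⊕ Fin g → ℝ) ≃L[ℝ] Ec}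
    (hΨ : ∀ v, latticeJ Ψc v = -latticeJ (siegelPeriodEquiv hδ hZ) v) :
    IsIsomorphic (siegelPeriodEquiv hδ hZ) Ψc :=
  (isIsomorphic_neg_conj_of_blockRel_of_comm hδ hZ j hjj hjZ hjΔ).trans
    (isIsomorphic_conj_presentation_of_type hδ hZ (neg_map_conj_mem_siegelUpperHalfSpace hZ) rfl hΨ).symm

/-- **Shimura's Prop. 12 for the torus `X^δ_Z` of type `δ`, every genus `g ≥ 1`.**  If `j² = −1`,
`jZ = −Z̄j`, `jΔ = Δj` and every holomorphic automorphism `ρ(P)` of `X^δ_Z` (`P` invertible over `ℤ`) is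
`±1`, then `X^δ_Z` has NO real structure at all: `τ = ρ((−j) ⊕ j)` anti-commutes with `J^δ_Z` and `τ² = −1`
(§4), and g48-#4 `isEmpty_realStructure_of_mul_self_eq_neg_one` applies («`λ⁻¹ ∘ μ^ρ ∘ μ⁻¹ = ±1` …
contradicts `λ^ρ ∘ λ = −1`»). [cite: Shimura1972FieldOfRationality, §3 Prop. 12, p. 176] [cite: Silhol1989, Ch. I (1.3), p. 3] -/
theorem isEmpty_realStructure_of_blockRel_of_comm (hg : 0 < g) (hjj : j * j = -1)
    (hjZ : j.map (Int.cast : ℤ → ℂ) * Z = -Z.map conj * j.map (Int.cast : ℤ → ℂ))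
    (hjΔ : j * Matrix.diagonal (fun i ↦ (δ i : ℤ)) = Matrix.diagonal (fun i ↦ (δ i : ℤ)) * j)
    (hEnd : ∀ P : Matrix (Fin g ⊕ Fin g) (Fin g ⊕ Fin g) ℤ,
      MDifferentiable 𝓘(ℂ, Fin g → ℂ) 𝓘(ℂ, Fin g → ℂ)
          (mapMatrix (siegelPeriodEquiv hδ hZ) (siegelPeriodEquiv hδ hZ) P) →
        (∃ Q : Matrix (Fin g ⊕ Fin g) (Fin g ⊕ Fin g) ℤ, P * Q = 1 ∧ Q * P = 1) → P = 1 ∨ P = -1) :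
    IsEmpty (RealStructure 𝓘(ℂ, Fin g → ℂ) (ComplexTorus (siegelPeriodEquiv hδ hZ))) :=
  haveI : Nonempty (Fin g ⊕ Fin g) := ⟨Sum.inl ⟨0, hg⟩⟩
  isEmpty_realStructure_of_mul_self_eq_neg_one hEnd (negBlockDiag_mulVec_latticeJ_eq_neg_of_comm hδ hZ j hjZ hjΔ)
    (negBlockDiag_mul_negBlockDiag j hjj)

/-- **On `𝔜_j` with `End(X^δ_Z)^* = {±1}` every anti-holomorphic lattice automorphism of `X^δ_Z` squares to
`−1`**: every isomorphism `X^δ_Z ⥲ X̄` behaves like Shimura's `λ` (`λ^ρ ∘ λ = −1`); none is an involution.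
[cite: Shimura1972FieldOfRationality, §3 Prop. 10 and Prop. 12, pp. 174–176] -/
theorem forall_mul_self_eq_neg_one_of_blockRel_of_comm (hg : 0 < g) (hjj : j * j = -1)
    (hjZ : j.map (Int.cast : ℤ → ℂ) * Z = -Z.map conj * j.map (Int.cast : ℤ → ℂ))
    (hjΔ : j * Matrix.diagonal (fun i ↦ (δ i : ℤ)) = Matrix.diagonal (fun i ↦ (δ i : ℤ)) * j)
    (hEnd : ∀ P : Matrix (Fin g ⊕ Fin g) (Fin g ⊕ Fin g) ℤ,
      MDifferentiable 𝓘(ℂ, Fin g → ℂ) 𝓘(ℂ, Fin g → ℂ)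
          (mapMatrix (siegelPeriodEquiv hδ hZ) (siegelPeriodEquiv hδ hZ) P) →
        (∃ Q : Matrix (Fin g ⊕ Fin g) (Fin g ⊕ Fin g) ℤ, P * Q = 1 ∧ Q * P = 1) → P = 1 ∨ P = -1)
    {T T' : Matrix (Fin g ⊕ Fin g) (Fin g ⊕ Fin g) ℤ} (hTT' : T * T' = 1) (hT'T : T' * T = 1)
    (hT : ∀ x, T.map (Int.cast : ℤ → ℝ) *ᵥ latticeJ (siegelPeriodEquiv hδ hZ) x =
      -latticeJ (siegelPeriodEquiv hδ hZ) (T.map (Int.cast : ℤ → ℝ) *ᵥ x)) :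
    T * T = -1 := by
  rcases mul_self_eq_one_or_eq_neg_one_of_anticomm hEnd hT hTT' hT'T with h | h
  · exact ((isEmpty_realStructure_of_blockRel_of_comm hδ hZ j hg hjj hjZ hjΔ hEnd).false
      (isRealStructure_mapMatrix (Φ := siegelPeriodEquiv hδ hZ) hT h).1.toRealStructure).elim
  · exact h

/-- **Prop. 10 + Prop. 12 in type `δ` — summary on `𝔜_j`.**  For a type `δ`, an integral `j` with
`j² = −1`, `ᵗj j = 1`, `jΔ = Δj` (condition (5)), `g ≥ 1`, and `Z ∈ 𝔥_g` with `jZ = −Z̄j` whose torus of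
type `δ` has `End(X^δ_Z)^* = {±1}`: the polarized torus `(X^δ_Z, E^δ_Z)` IS isomorphic to its conjugate
`(X^δ_{−Z̄}, E^δ_{−Z̄})` («the field of moduli of `P_z` is contained in `ℝ`»), `X^δ_Z` is isomorphic to every
conjugate presentation, and yet `X^δ_Z` carries NO real structure («`P_z` has no model rational over its
field of moduli»). [cite: Shimura1972FieldOfRationality, §3 Prop. 10 and Prop. 12, pp. 174–176] -/
theorem exists_isPolarizedIso_conj_and_isEmpty_realStructure_of_comm (hg : 0 < g) (hjj : j * j = -1)
    (hjT : jᵀ * j = 1) (hjZ : j.map (Int.cast : ℤ → ℂ) * Z = -Z.map conj * j.map (Int.cast : ℤ → ℂ))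
    (hjΔ : j * Matrix.diagonal (fun i ↦ (δ i : ℤ)) = Matrix.diagonal (fun i ↦ (δ i : ℤ)) * j)
    (hEnd : ∀ P : Matrix (Fin g ⊕ Fin g) (Fin g ⊕ Fin g) ℤ,
      MDifferentiable 𝓘(ℂ, Fin g → ℂ) 𝓘(ℂ, Fin g → ℂ)
          (mapMatrix (siegelPeriodEquiv hδ hZ) (siegelPeriodEquiv hδ hZ) P) →
        (∃ Q : Matrix (Fin g ⊕ Fin g) (Fin g ⊕ Fin g) ℤ, P * Q = 1 ∧ Q * P = 1) → P = 1 ∨ P = -1) :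
    (∃ h : ComplexTorus (siegelPeriodEquiv hδ hZ) ≃+
        ComplexTorus (siegelPeriodEquiv hδ (neg_map_conj_mem_siegelUpperHalfSpace hZ)),
      IsPolarizedIso (siegelPeriodEquiv hδ hZ) (siegelForm hδ hZ)
        (siegelPeriodEquiv hδ (neg_map_conj_mem_siegelUpperHalfSpace hZ))
        (siegelForm hδ (neg_map_conj_mem_siegelUpperHalfSpace hZ)) h ∧
      ∀ t, mapMatrix (siegelPeriodEquiv hδ (neg_map_conj_mem_siegelUpperHalfSpace hZ)) (siegelPeriodEquiv hδ hZ)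
          (Matrix.fromBlocks j 0 0 j) (h t) = -t) ∧
    (∀ {Ec : Type} [NormedAddCommGroup Ec] [NormedSpace ℂ Ec] (Ψc : (Fin g ⊕ Fin g → ℝ) ≃L[ℝ] Ec),
        (∀ v, latticeJ Ψc v = -latticeJ (siegelPeriodEquiv hδ hZ) v) →
          IsIsomorphic (siegelPeriodEquiv hδ hZ) Ψc) ∧
    IsEmpty (RealStructure 𝓘(ℂ, Fin g → ℂ) (ComplexTorus (siegelPeriodEquiv hδ hZ))) := by
  obtain ⟨h, hh, hcoe, -⟩ := exists_isPolarizedIso_blockDiag_of_comm hδ hZ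
    (neg_map_conj_mem_siegelUpperHalfSpace hZ) j hjT hjZ hjΔ
  refine ⟨⟨h, hh, fun t ↦ ?_⟩, fun Ψc hΨ ↦ isIsomorphic_conj_presentation_of_blockRel_of_comm hδ hZ j hjj hjZ hjΔ hΨ,
    isEmpty_realStructure_of_blockRel_of_comm hδ hZ j hg hjj hjZ hjΔ hEnd⟩
  rw [hcoe, mapMatrix_mapMatrix, blockDiag_mul_blockDiag j hjj, mapMatrix_neg, mapMatrix_one]

end PropTwelve

/-! ## §6 Condition (5): `δ = (d 0; 0 d)` and `j₀ = (0 −1_m; 1_m 0)` commute -/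

section ConditionFive

variable {m : ℕ}

/-- **Condition (5) gives `jΔ = Δj`**: Shimura's `j₀ = (0 −1_m; 1_m 0)` commutes with `Δ = diag(d, d)` for
every diagonal `d` of size `m` («we may assume … that `δ` itself is of the form `(d 0; 0 d)`»); here on
`Fin (m + m)` along `Fin m ⊕ Fin m ≃ Fin (m + m)`. [cite: Shimura1972FieldOfRationality, §3 condition (5) and Prop. 10, p. 174] -/
theorem blockJ_mul_blockDiagonal_comm (d : Fin m → ℕ) :
    Matrix.reindex finSumFinEquiv finSumFinEquiv
          (Matrix.fromBlocks (0 : Matrix (Fin m) (Fin m) ℤ) (-1 : Matrix (Fin m) (Fin m) ℤ)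
            (1 : Matrix (Fin m) (Fin m) ℤ) (0 : Matrix (Fin m) (Fin m) ℤ)) *
        Matrix.diagonal (fun i : Fin (m + m) ↦ ((Sum.elim d d (finSumFinEquiv.symm i) : ℕ) : ℤ)) =
      Matrix.diagonal (fun i : Fin (m + m) ↦ ((Sum.elim d d (finSumFinEquiv.symm i) : ℕ) : ℤ)) *
        Matrix.reindex finSumFinEquiv finSumFinEquiv
          (Matrix.fromBlocks (0 : Matrix (Fin m) (Fin m) ℤ) (-1 : Matrix (Fin m) (Fin m) ℤ)
            (1 : Matrix (Fin m) (Fin m) ℤ) (0 : Matrix (Fin m) (Fin m) ℤ)) := by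
  have hΔ : Matrix.diagonal (fun i : Fin (m + m) ↦ ((Sum.elim d d (finSumFinEquiv.symm i) : ℕ) : ℤ)) =
      Matrix.reindex finSumFinEquiv finSumFinEquiv
        (Matrix.fromBlocks (Matrix.diagonal fun k ↦ (d k : ℤ)) 0 0 (Matrix.diagonal fun k ↦ (d k : ℤ))) := by
    rw [Matrix.fromBlocks_diagonal, Matrix.reindex_apply, Matrix.submatrix_diagonal_equiv]
    congr 1
    funext i
    simp only [Function.comp_apply]
    cases finSumFinEquiv.symm i <;> rfl
  rw [hΔ, Matrix.reindex_apply, Matrix.reindex_apply, Matrix.submatrix_mul_equiv, Matrix.submatrix_mul_equiv,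
    Matrix.fromBlocks_multiply, Matrix.fromBlocks_multiply]
  simp

/-- `j₀² = −1`, `ᵗj₀ j₀ = 1` for the re-indexed `j₀` (g48-#6 `locusJ_mul_self_and_transpose`). [cite: Shimura1972FieldOfRationality, §3 Prop. 10, p. 174] -/
private theorem blockJ_reindex_props_g50b :
    Matrix.reindex finSumFinEquiv finSumFinEquiv
          (Matrix.fromBlocks (0 : Matrix (Fin m) (Fin m) ℤ) (-1 : Matrix (Fin m) (Fin m) ℤ)
            (1 : Matrix (Fin m) (Fin m) ℤ) (0 : Matrix (Fin m) (Fin m) ℤ)) *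
        Matrix.reindex finSumFinEquiv finSumFinEquiv
          (Matrix.fromBlocks (0 : Matrix (Fin m) (Fin m) ℤ) (-1 : Matrix (Fin m) (Fin m) ℤ)
            (1 : Matrix (Fin m) (Fin m) ℤ) (0 : Matrix (Fin m) (Fin m) ℤ)) = -1 ∧
      (Matrix.reindex finSumFinEquiv finSumFinEquiv
          (Matrix.fromBlocks (0 : Matrix (Fin m) (Fin m) ℤ) (-1 : Matrix (Fin m) (Fin m) ℤ)
            (1 : Matrix (Fin m) (Fin m) ℤ) (0 : Matrix (Fin m) (Fin m) ℤ)))ᵀ *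
        Matrix.reindex finSumFinEquiv finSumFinEquiv
          (Matrix.fromBlocks (0 : Matrix (Fin m) (Fin m) ℤ) (-1 : Matrix (Fin m) (Fin m) ℤ)
            (1 : Matrix (Fin m) (Fin m) ℤ) (0 : Matrix (Fin m) (Fin m) ℤ)) = 1 := by
  obtain ⟨h1, -, h3⟩ := locusJ_mul_self_and_transpose (m := m) rfl
  exact ⟨h1, h3⟩

/-- **Prop. 10 + Prop. 12 AS PRINTED: type `δ = (d 0; 0 d)` (condition (5)), `j = j₀ = (0 −1_m; 1_m 0)`,
`n = 2m ≥ 2`.**  For every `z ∈ 𝔜` (`j₀z = −z^ρ j₀`) whose polarized torus `P_z = (X^δ_Z, E^δ_Z)` of type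
`(d, d)` has `End^* = {±1}`: `P_z ≅ P_z^ρ` by `λ = ρ(j₀ ⊕ j₀)` with `λ^ρ ∘ λ = −1`, `X^δ_Z ≅` every conjugate
presentation, and `P_z` has no model over `ℝ` (`IsEmpty (RealStructure X^δ_Z)`).
[cite: Shimura1972FieldOfRationality, §3 condition (5), Prop. 10 and Prop. 12, pp. 174–176] -/
theorem exists_isPolarizedIso_conj_and_isEmpty_realStructure_typeFive (hm : 0 < m) (d : Fin m → ℕ)
    (hd : ∀ i : Fin (m + m), 0 < (fun i : Fin (m + m) ↦ Sum.elim d d (finSumFinEquiv.symm i)) i)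
    {Z : Matrix (Fin (m + m)) (Fin (m + m)) ℂ} (hZ : Z ∈ siegelUpperHalfSpace (m + m))
    (hjZ : (Matrix.reindex finSumFinEquiv finSumFinEquiv
          (Matrix.fromBlocks (0 : Matrix (Fin m) (Fin m) ℤ) (-1 : Matrix (Fin m) (Fin m) ℤ)
            (1 : Matrix (Fin m) (Fin m) ℤ) (0 : Matrix (Fin m) (Fin m) ℤ))).map (Int.cast : ℤ → ℂ) * Z =
      -Z.map conj * (Matrix.reindex finSumFinEquiv finSumFinEquiv
          (Matrix.fromBlocks (0 : Matrix (Fin m) (Fin m) ℤ) (-1 : Matrix (Fin m) (Fin m) ℤ)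
            (1 : Matrix (Fin m) (Fin m) ℤ) (0 : Matrix (Fin m) (Fin m) ℤ))).map (Int.cast : ℤ → ℂ))
    (hEnd : ∀ P : Matrix (Fin (m + m) ⊕ Fin (m + m)) (Fin (m + m) ⊕ Fin (m + m)) ℤ,
      MDifferentiable 𝓘(ℂ, Fin (m + m) → ℂ) 𝓘(ℂ, Fin (m + m) → ℂ)
          (mapMatrix (siegelPeriodEquiv hd hZ) (siegelPeriodEquiv hd hZ) P) →
        (∃ Q : Matrix (Fin (m + m) ⊕ Fin (m + m)) (Fin (m + m) ⊕ Fin (m + m)) ℤ, P * Q = 1 ∧ Q * P = 1) →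
          P = 1 ∨ P = -1) :
    (∃ h : ComplexTorus (siegelPeriodEquiv hd hZ) ≃+
        ComplexTorus (siegelPeriodEquiv hd (neg_map_conj_mem_siegelUpperHalfSpace hZ)),
      IsPolarizedIso (siegelPeriodEquiv hd hZ) (siegelForm hd hZ)
        (siegelPeriodEquiv hd (neg_map_conj_mem_siegelUpperHalfSpace hZ))
        (siegelForm hd (neg_map_conj_mem_siegelUpperHalfSpace hZ)) h ∧
      ∀ t, mapMatrix (siegelPeriodEquiv hd (neg_map_conj_mem_siegelUpperHalfSpace hZ)) (siegelPeriodEquiv hd hZ)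
          (Matrix.fromBlocks
            (Matrix.reindex finSumFinEquiv finSumFinEquiv
              (Matrix.fromBlocks (0 : Matrix (Fin m) (Fin m) ℤ) (-1 : Matrix (Fin m) (Fin m) ℤ)
                (1 : Matrix (Fin m) (Fin m) ℤ) (0 : Matrix (Fin m) (Fin m) ℤ))) 0 0
            (Matrix.reindex finSumFinEquiv finSumFinEquiv
              (Matrix.fromBlocks (0 : Matrix (Fin m) (Fin m) ℤ) (-1 : Matrix (Fin m) (Fin m) ℤ)
                (1 : Matrix (Fin m) (Fin m) ℤ) (0 : Matrix (Fin m) (Fin m) ℤ)))) (h t) = -t) ∧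
    (∀ {Ec : Type} [NormedAddCommGroup Ec] [NormedSpace ℂ Ec] (Ψc : (Fin (m + m) ⊕ Fin (m + m) → ℝ) ≃L[ℝ] Ec),
        (∀ v, latticeJ Ψc v = -latticeJ (siegelPeriodEquiv hd hZ) v) →
          IsIsomorphic (siegelPeriodEquiv hd hZ) Ψc) ∧
    IsEmpty (RealStructure 𝓘(ℂ, Fin (m + m) → ℂ) (ComplexTorus (siegelPeriodEquiv hd hZ))) := by
  obtain ⟨h1, h3⟩ := blockJ_reindex_props_g50b (m := m)
  exact exists_isPolarizedIso_conj_and_isEmpty_realStructure_of_comm hd hZ _ (by omega) h1 h3 hjZ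
    (blockJ_mul_blockDiagonal_comm d) hEnd

end ConditionFive

end SiegelModuli

end Literature.AlgebraicGeometry.ModuliOfAbelianVarieties
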